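import Mathlib
import Summits.ValiantsHypothesis.ValiantsHypothesis.Theorems.FeketeSOSSOSMagnificationStubBudget

/-!
# Crux `SOSTau.HutchinsonMagnification` (stmt-ValiantsHypothesis-18749), line `SketchWitness`: stub T3 `stub_hexBudget`

The LINEAR-threshold budget of the magnification at the fixed radix `16`: for every complexity exponent `c` and every
`η > 0`, eventually in the level `m`, for all `L ≤ m^c + c`,
`2^{m+1} · (m+1)·((4L(m+1)²)·(4L(m+1)²))^{⌊log₂ m⌋} · (16^{⌊m/2⌋} + 16^{m−⌊m/2⌋}) < η · 2^{4m}`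
(the number of polarised squares of the VSBR middle cut times the two half-lift sparsities, against `η·16^m`):
the quasi-polynomial factor is `≤ 2^{(M+1)((2c+10)M+1)}` with `M = ⌊log₂ m⌋`, the halves are `≤ 2^{2m+3}`, and
`E + K + 5 ≤ m` once `M ≥ 10(2c+K+17)` (landed `mul_sq_le_two_pow`), where `η > 2^{-K}`.  This is the `d^{1/2+o(1)}`
vs `η·d` comparison of Dutta 2021, Lemma 4 / Thm 2 (there with `k ≥ 5^14 + 1`; here `k = 16` suffices because the
threshold is linear, not `d^{1/2+ε}`).

References: P. Dutta, *Real τ-conjecture for sum-of-squares: a unified approach to lower bound and derandomization*,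
CSR 2021 (LNCS 12730), Lemma 4 and the proof of Thm 2; P. Dutta, N. Saxena, T. Thierauf, ITCS 2021, Thm 6.
-/

set_option linter.dupNamespace false

open Summit.ValiantsHypothesis.ValiantsHypothesis.Theorems.FeketeSOSSOSMagnification (mul_sq_le_two_pow)

namespace Summit.ValiantsHypothesis.ValiantsHypothesis.Theorems.SOSTauHutchinsonMagnification

/-! ## T3: the linear-threshold budget at radix 16 -/

/-- `m^c + c ≤ (m+1)^{c+1}` for `m ≥ 1`. -/
theorem pow_add_le_succ_pow (m c : ℕ) (hm : 1 ≤ m) : m ^ c + c ≤ (m + 1) ^ (c + 1) := by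
  have h1 : m ^ c ≤ (m + 1) ^ c := Nat.pow_le_pow_left (Nat.le_succ m) c
  have h2 : c ≤ m * (m + 1) ^ c := by
    have : c < 2 ^ c := Nat.lt_two_pow_self
    have : 2 ^ c ≤ (m + 1) ^ c := Nat.pow_le_pow_left (by omega) c
    nlinarith
  calc m ^ c + c ≤ (m + 1) ^ c + m * (m + 1) ^ c := Nat.add_le_add h1 h2
    _ = (m + 1) ^ (c + 1) := by ring

/-- The quasi-polynomial factor is at most `2^{(M+1)((2c+10)M+1)}` with `M = log₂ m`. -/
theorem quasiPoly_le (c m L : ℕ) (hm : 1 ≤ m) (hL : L ≤ m ^ c + c) :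
    (m + 1) * ((4 * L * (m + 1) ^ 2) * (4 * L * (m + 1) ^ 2)) ^ Nat.log 2 m ≤
      2 ^ ((Nat.log 2 m + 1) * ((2 * c + 10) * Nat.log 2 m + 1)) := by
  set M := Nat.log 2 m with hM
  have hm2 : m + 1 ≤ 2 ^ (M + 1) := Nat.lt_pow_succ_log_self one_lt_two m
  have hL' : L ≤ (m + 1) ^ (c + 1) := hL.trans (pow_add_le_succ_pow m c hm)
  have h4 : 4 ≤ (m + 1) ^ 2 := by nlinarith
  have hX : 4 * L * (m + 1) ^ 2 ≤ (m + 1) ^ (c + 5) := by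
    calc 4 * L * (m + 1) ^ 2 ≤ (m + 1) ^ 2 * (m + 1) ^ (c + 1) * (m + 1) ^ 2 := by
          gcongr
      _ = (m + 1) ^ (c + 5) := by ring
  have hXX : (4 * L * (m + 1) ^ 2) * (4 * L * (m + 1) ^ 2) ≤ (m + 1) ^ (2 * c + 10) := by
    calc (4 * L * (m + 1) ^ 2) * (4 * L * (m + 1) ^ 2) ≤ (m + 1) ^ (c + 5) * (m + 1) ^ (c + 5) :=
          Nat.mul_le_mul hX hX
      _ = (m + 1) ^ (2 * c + 10) := by ring
  calc (m + 1) * ((4 * L * (m + 1) ^ 2) * (4 * L * (m + 1) ^ 2)) ^ M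
      ≤ (m + 1) * ((m + 1) ^ (2 * c + 10)) ^ M := Nat.mul_le_mul_left _ (Nat.pow_le_pow_left hXX M)
    _ = (m + 1) ^ ((2 * c + 10) * M + 1) := by rw [← pow_mul, ← pow_succ']
    _ ≤ (2 ^ (M + 1)) ^ ((2 * c + 10) * M + 1) := Nat.pow_le_pow_left hm2 _
    _ = 2 ^ ((M + 1) * ((2 * c + 10) * M + 1)) := by rw [← pow_mul]

/-- The two half-lift sparsities: `16^{⌊m/2⌋} + 16^{⌈m/2⌉} ≤ 2^{2m+3}`. -/
theorem halves_le (m : ℕ) : 16 ^ (m / 2) + 16 ^ (m - m / 2) ≤ 2 ^ (2 * m + 3) := by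
  have h1 : 16 ^ (m / 2) ≤ 16 ^ (m - m / 2) := Nat.pow_le_pow_right (by norm_num) (by omega)
  have h2 : 16 ^ (m - m / 2) = 2 ^ (4 * (m - m / 2)) := by
    rw [pow_mul]; norm_num
  have h3 : 2 ^ (4 * (m - m / 2)) ≤ 2 ^ (2 * m + 2) := Nat.pow_le_pow_right (by norm_num) (by omega)
  calc 16 ^ (m / 2) + 16 ^ (m - m / 2) ≤ 2 * 16 ^ (m - m / 2) := by omega
    _ ≤ 2 * 2 ^ (2 * m + 2) := by rw [h2]; exact Nat.mul_le_mul_left 2 h3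
    _ = 2 ^ (2 * m + 3) := by ring

/-- **Stub T3 `stub_hexBudget` of line `SketchWitness` (crux stmt-ValiantsHypothesis-18749):** quasi-polynomial · `8^m` is
eventually below `η · 16^m`, uniformly in `L ≤ m^c + c`. -/
theorem stub_hexBudget :
    ∀ (c : ℕ) (η : ℝ), 0 < η → ∃ m₀ : ℕ, ∀ m : ℕ, m₀ ≤ m → ∀ L : ℕ, L ≤ m ^ c + c →
      ((2 ^ (m + 1) * ((m + 1) * ((4 * L * (m + 1) ^ 2) * (4 * L * (m + 1) ^ 2)) ^ Nat.log 2 m) *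
          (16 ^ (m / 2) + 16 ^ (m - m / 2)) : ℕ) : ℝ) < η * 2 ^ (4 * m) := by
  intro c η hη
  -- `η > (1/2)^K`
  obtain ⟨K, hK⟩ := exists_pow_lt_of_lt_one hη (by norm_num : (1 / 2 : ℝ) < 1)
  -- the threshold: `M = log₂ m ≥ 10 (A + 1)` with `A = 2c + K + 16`
  set A := 2 * c + K + 16 with hA
  refine ⟨2 ^ (10 * (A + 1)), fun m hm L hL => ?_⟩
  have hm1 : 1 ≤ m := le_trans Nat.one_le_two_pow hm
  set M := Nat.log 2 m with hM
  have hMge : 10 * (A + 1) ≤ M := Nat.le_log_of_pow_le one_lt_two hm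
  have h2M : 2 ^ M ≤ m := Nat.pow_log_le_self 2 (by omega)
  -- the exponent budget `E + K + 5 ≤ m`
  set E := (M + 1) * ((2 * c + 10) * M + 1) with hE
  have hEm : E + K + 5 ≤ m := by
    have hsq := mul_sq_le_two_pow A M hMge
    have : E + K + 5 ≤ A * (M + 1) ^ 2 := by
      rw [hE, hA]
      nlinarith [Nat.zero_le M, Nat.zero_le c, Nat.zero_le K]
    omega
  -- the ℕ bound `N · 2^{K+1} ≤ 2^{4m}`
  have hT := quasiPoly_le c m L hm1 hL
  have hH := halves_le m
  set N := 2 ^ (m + 1) * ((m + 1) * ((4 * L * (m + 1) ^ 2) * (4 * L * (m + 1) ^ 2)) ^ Nat.log 2 m) *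
    (16 ^ (m / 2) + 16 ^ (m - m / 2)) with hN
  have hNle : N ≤ 2 ^ (3 * m + 4 + E) := by
    calc N ≤ 2 ^ (m + 1) * 2 ^ E * 2 ^ (2 * m + 3) := by
          rw [hN]; exact Nat.mul_le_mul (Nat.mul_le_mul_left _ hT) hH
      _ = 2 ^ (3 * m + 4 + E) := by rw [← pow_add, ← pow_add]; congr 1; ring
  have hNK : N * 2 ^ (K + 1) ≤ 2 ^ (4 * m) := by
    calc N * 2 ^ (K + 1) ≤ 2 ^ (3 * m + 4 + E) * 2 ^ (K + 1) := Nat.mul_le_mul_right _ hNle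
      _ = 2 ^ (3 * m + 4 + E + (K + 1)) := by rw [← pow_add]
      _ ≤ 2 ^ (4 * m) := Nat.pow_le_pow_right (by norm_num) (by omega)
  -- to ℝ
  have hR : (N : ℝ) * 2 ^ (K + 1) ≤ 2 ^ (4 * m) := by exact_mod_cast hNK
  have h2K : (0 : ℝ) < 2 ^ (K + 1) := by positivity
  have hηK : 1 < η * 2 ^ (K + 1) := by
    have h1 : (1 / 2 : ℝ) ^ K * 2 ^ (K + 1) = 2 := by
      rw [pow_succ, one_div, inv_pow, ← mul_assoc, inv_mul_cancel₀ (by positivity)]; ring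
    nlinarith [mul_lt_mul_of_pos_right hK h2K]
  have h4m : (0 : ℝ) < 2 ^ (4 * m) := by positivity
  -- `N ≤ 2^{4m}/2^{K+1} < η 2^{4m}`
  by_contra hcon
  push Not at hcon
  have := mul_le_mul_of_nonneg_right hcon h2K.le
  nlinarith

end Summit.ValiantsHypothesis.ValiantsHypothesis.Theorems.SOSTauHutchinsonMagnification
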